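import Summits.KontsevichZagierPeriods.KontsevichZagierPeriods.Theorems.LinRedNormalFormArrangementNormalFormSeparateDominated

/-!
# Cancelling a fat letter: the lower bound (stub `stub_separateThreeZero`, part `FatLower`)

(Line `janus-bands`, crux `ArrangementNormalForm`, stub `stub_separateThreeZero` — fibre-free
separation over a bounded rational polytope in `ℝ³`, `JJ 3 0 → closure (GG 2 1 0)`; part
`FatLower` of the CANCELLATION lemma `JJ 3 0 ≡ thin JJ 3 0`.)

`SepThree.fat_lower` (registered as `separateThree_fat_lower`): near a point `z₁` where the
numerator `P` does not vanish, the arrangement integrand `P/∏ L_i^{e_i}` on a bounded cell on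
which the active letters do not vanish is bounded below by `c'/|y − λ_j(x')|` for every active
`y`-letter `L_j = α_j (y − λ_j(x'))` (`c' > 0`): `|P| ≥ |P(z₁)|/2` by continuity and
`∏ |L_i|^{e_i} ≤ |L_j| · K` by boundedness. This is the input `hlow` of `SepThree.fat_diverge`.
Also: the base cell `gDom` is open (`SepThree.isOpen_gDom`).
-/

noncomputable section

open Set MeasureTheory Filter Topology

namespace Summit.KontsevichZagierPeriods.ArrangementNormalForm.JanusBands

open Literature.NumberTheory.Transcendental

namespace SepThree

open SeparatePos MvPolynomial

variable {b k : ℕ}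

/-- The base cell `gDom` (polyhedral base × Janus fibres) is open. -/
theorem isOpen_gDom (m' : ℕ) (M : Fin m' → (Fin (b + 1) → ℚ) × ℚ)
    (lo hi : Fin k → Fin k ⊕ ((Fin (b + 1) → ℚ) × ℚ)) : IsOpen (gDom b k m' M lo hi) := by
  have hform : ∀ c : (Fin (b + 1) → ℚ) × ℚ, Continuous fun z : Fin (b + 1 + k) → ℝ =>
      ∑ i, (c.1 i : ℝ) * z (Fin.castAdd k i) + (c.2 : ℝ) := fun c => by fun_prop
  have helim : ∀ x : Fin k ⊕ ((Fin (b + 1) → ℚ) × ℚ), Continuous fun z : Fin (b + 1 + k) → ℝ =>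
      Sum.elim (fun j => z (Fin.natAdd (b + 1) j))
        (fun c => ∑ i', (c.1 i' : ℝ) * z (Fin.castAdd k i') + (c.2 : ℝ)) x := fun x => by
    cases x with
    | inl j => exact continuous_apply _
    | inr c => exact hform c
  simp only [gDom, Set.setOf_and, Set.setOf_forall]
  refine (isOpen_iInter_of_finite fun j => isOpen_lt continuous_const (hform (M j))).inter
    (isOpen_iInter_of_finite fun i => (isOpen_lt (helim (lo i)) (continuous_apply _)).inter
      (isOpen_lt (continuous_apply _) (helim (hi i))))

/-- **The lower bound near a point where the numerator does not vanish**: see the module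
docstring. -/
theorem fat_lower {m : ℕ} (L : Fin m → (Fin (2 + 1) → ℚ) × ℚ) (e : Fin m → ℕ)
    (p : MvPolynomial (Fin (2 + 1)) ℚ) (a : Fin 0 → Option ((Fin (2 + 1) → ℚ) × ℚ))
    {D : Set (Fin (2 + 1 + 0) → ℝ)} (hbd : Bornology.IsBounded D)
    (hnz : ∀ i, e i ≠ 0 → ∀ z ∈ D, affF 2 0 (L i) z ≠ 0) (j : Fin m) (hej : e j ≠ 0)
    (hα : (L j).1 (Fin.last 2) ≠ 0) (z₁ : Fin (2 + 1 + 0) → ℝ)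
    (hp : MvPolynomial.aeval (fun i => z₁ (Fin.castAdd 0 i)) p ≠ 0) :
    ∃ c' > (0 : ℝ), ∃ ρ₁ > (0 : ℝ), ∀ z ∈ D, dist z z₁ < ρ₁ →
      c' / |z (Fin.castAdd 0 (Fin.last 2)) - affB 2 0 (root 2 (L j)) z| ≤
        |MvPolynomial.aeval (fun i => z (Fin.castAdd 0 i)) p / (∏ i, affF 2 0 (L i) z ^ e i) *
          SeparatePos.fib 2 0 a z| := by
  classical
  -- continuity of the numerator
  set P : (Fin (2 + 1 + 0) → ℝ) → ℝ := fun z => MvPolynomial.aeval (fun i => z (Fin.castAdd 0 i)) p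
    with hP
  have hPc : Continuous P :=
    (Literature.ModelTheory.ExponentialFields.continuous_aeval_real p).comp
      (continuous_pi fun i => continuous_apply _)
  have hP1 : 0 < |P z₁| := abs_pos.2 hp
  obtain ⟨ρ₁, hρ₁, hcont⟩ := Metric.continuous_iff.1 hPc z₁ (|P z₁| / 2) (by positivity)
  -- the a priori bound of the letters
  obtain ⟨R, hR⟩ := hbd.exists_norm_le
  set R' : ℝ := 1 + ∑ i, ((∑ l, |((L i).1 l : ℝ)|) * |R| + |((L i).2 : ℝ)|) with hR'
  have hR'1 : 1 ≤ R' := by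
    rw [hR']
    have : 0 ≤ ∑ i, ((∑ l, |((L i).1 l : ℝ)|) * |R| + |((L i).2 : ℝ)|) :=
      Finset.sum_nonneg fun i _ => by positivity
    linarith
  have hR'0 : 0 < R' := by linarith
  have hlet : ∀ i, ∀ z ∈ D, |affF 2 0 (L i) z| ≤ R' := fun i z hz => by
    have h1 := abs_affF_le (k := 0) (L i) (hR z hz)
    have h2 : (∑ l, |((L i).1 l : ℝ)|) * R + |((L i).2 : ℝ)| ≤
        (∑ l, |((L i).1 l : ℝ)|) * |R| + |((L i).2 : ℝ)| := by
      have hs : (0 : ℝ) ≤ ∑ l, |((L i).1 l : ℝ)| := Finset.sum_nonneg fun l _ => abs_nonneg _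
      have := mul_le_mul_of_nonneg_left (le_abs_self R) hs
      linarith
    have h3 : (∑ l, |((L i).1 l : ℝ)|) * |R| + |((L i).2 : ℝ)| ≤
        ∑ i, ((∑ l, |((L i).1 l : ℝ)|) * |R| + |((L i).2 : ℝ)|) :=
      Finset.single_le_sum (f := fun i => (∑ l, |((L i).1 l : ℝ)|) * |R| + |((L i).2 : ℝ)|)
        (fun i _ => by positivity) (Finset.mem_univ i)
    rw [hR']
    linarith
  -- the constants
  set E : ℕ := ∑ i, e i with hE
  set K : ℝ := R' ^ E * R' ^ E with hK
  have hK0 : 0 < K := by positivity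
  have hαR : (0 : ℝ) < |((L j).1 (Fin.last 2) : ℝ)| := abs_pos.2 (by exact_mod_cast hα)
  refine ⟨|P z₁| / (2 * K * |((L j).1 (Fin.last 2) : ℝ)|), by positivity, ρ₁, hρ₁,
    fun z hz hdz => ?_⟩
  -- the numerator near `z₁`
  have hPz : |P z₁| / 2 ≤ |P z| := by
    have h1 := hcont z hdz
    rw [Real.dist_eq] at h1
    have h2 := abs_sub_abs_le_abs_sub (P z₁) (P z)
    rw [abs_sub_comm] at h2
    linarith
  -- the denominator
  set ℓ : Fin m → ℝ := fun i => affF 2 0 (L i) z with hℓ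
  have hℓb : ∀ i, |ℓ i| ≤ R' := fun i => hlet i z hz
  have hℓnz : ∀ i, e i ≠ 0 → ℓ i ≠ 0 := fun i hi => hnz i hi z hz
  have hpow_le : ∀ i, |ℓ i| ^ e i ≤ R' ^ e i := fun i =>
    pow_le_pow_left₀ (abs_nonneg _) (hℓb i) _
  have hprod_pos : 0 < |∏ i, ℓ i ^ e i| := by
    rw [abs_pos]
    exact Finset.prod_ne_zero_iff.2 fun i _ => by
      by_cases hi : e i = 0
      · rw [hi, pow_zero]; exact one_ne_zero
      · exact pow_ne_zero _ (hℓnz i hi)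
  have hprod_le : |∏ i, ℓ i ^ e i| ≤ K * |ℓ j| := by
    rw [Finset.abs_prod, ← Finset.mul_prod_erase Finset.univ (fun i => |ℓ i ^ e i|)
      (Finset.mem_univ j)]
    have h1 : ∏ i ∈ Finset.univ.erase j, |ℓ i ^ e i| ≤ R' ^ E := by
      calc ∏ i ∈ Finset.univ.erase j, |ℓ i ^ e i| ≤ ∏ i ∈ Finset.univ.erase j, R' ^ e i := by
            refine Finset.prod_le_prod (fun i _ => abs_nonneg _) fun i _ => ?_
            rw [abs_pow]; exact hpow_le i
        _ = R' ^ (∑ i ∈ Finset.univ.erase j, e i) := Finset.prod_pow_eq_pow_sum _ _ _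
        _ ≤ R' ^ E := pow_le_pow_right₀ hR'1 (Finset.sum_le_sum_of_subset_of_nonneg
            (Finset.erase_subset _ _) fun i _ _ => Nat.zero_le _)
    have h2 : |ℓ j ^ e j| ≤ |ℓ j| * R' ^ E := by
      obtain ⟨n, hn⟩ := Nat.exists_eq_succ_of_ne_zero hej
      rw [abs_pow, hn, pow_succ, mul_comm]
      refine mul_le_mul_of_nonneg_left ?_ (abs_nonneg _)
      calc |ℓ j| ^ n ≤ R' ^ n := pow_le_pow_left₀ (abs_nonneg _) (hℓb j) _
        _ ≤ R' ^ E := pow_le_pow_right₀ hR'1 (by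
            have : e j ≤ E := Finset.single_le_sum (f := e) (fun i _ => Nat.zero_le _)
              (Finset.mem_univ j)
            omega)
    calc |ℓ j ^ e j| * ∏ i ∈ Finset.univ.erase j, |ℓ i ^ e i|
        ≤ (|ℓ j| * R' ^ E) * R' ^ E :=
          mul_le_mul h2 h1 (Finset.prod_nonneg fun i _ => abs_nonneg _) (by positivity)
      _ = K * |ℓ j| := by rw [hK]; ring
  -- the letter `j`
  have hℓj : ℓ j = ((L j).1 (Fin.last 2) : ℝ) *
      (z (Fin.castAdd 0 (Fin.last 2)) - affB 2 0 (root 2 (L j)) z) := affF_of_ne_zero (L j) z hα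
  have hyj : 0 < |z (Fin.castAdd 0 (Fin.last 2)) - affB 2 0 (root 2 (L j)) z| := by
    have h1 := hℓnz j hej
    rw [hℓj] at h1
    exact abs_pos.2 (right_ne_zero_of_mul h1)
  -- the integrand
  have hfib : SeparatePos.fib 2 0 a z = 1 := by simp [SeparatePos.fib]
  rw [hfib, mul_one, abs_div]
  have e1 : |P z₁| / (2 * K * |((L j).1 (Fin.last 2) : ℝ)|) /
      |z (Fin.castAdd 0 (Fin.last 2)) - affB 2 0 (root 2 (L j)) z| = (|P z₁| / 2) / (K * |ℓ j|) := by
    rw [hℓj, abs_mul]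
    field_simp
  rw [e1]
  exact div_le_div₀ (abs_nonneg _) hPz hprod_pos hprod_le

end SepThree

open SepThree SeparatePos in
/-- **The lower bound near a point where the numerator does not vanish** (registered sub-goal
of `stub_separateThreeZero`, part `FatLower`; see `SepThree.fat_lower`). -/
theorem separateThree_fat_lower (m : ℕ) (L : Fin m → (Fin (2 + 1) → ℚ) × ℚ) (e : Fin m → ℕ) (p : MvPolynomial (Fin (2 + 1)) ℚ) (a : Fin 0 → Option ((Fin (2 + 1) → ℚ) × ℚ)) (D : Set (Fin (2 + 1 + 0) → ℝ)) (hbd : Bornology.IsBounded D) (hnz : ∀ i, e i ≠ 0 → ∀ z ∈ D, SeparatePos.affF 2 0 (L i) z ≠ 0) (j : Fin m) (hej : e j ≠ 0) (hα : (L j).1 (Fin.last 2) ≠ 0) (z₁ : Fin (2 + 1 + 0) → ℝ) (hp : MvPolynomial.aeval (fun i => z₁ (Fin.castAdd 0 i)) p ≠ 0) : ∃ c' > (0 : ℝ), ∃ ρ₁ > (0 : ℝ), ∀ z ∈ D, dist z z₁ < ρ₁ → c' / |z (Fin.castAdd 0 (Fin.last 2)) - SeparatePos.affB 2 0 (SeparatePos.root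 2 (L j)) z| ≤ |MvPolynomial.aeval (fun i => z (Fin.castAdd 0 i)) p / (∏ i, SeparatePos.affF 2 0 (L i) z ^ e i) * SeparatePos.fib 2 0 a z| :=
  fat_lower L e p a hbd hnz j hej hα z₁ hp

end Summit.KontsevichZagierPeriods.ArrangementNormalForm.JanusBands
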